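import Summits.ValiantsHypothesis.ValiantsHypothesis.Theorems.DepthWindowHomBlocks
import Literature.Computability.AlgebraicComplexity.CircuitGateSemantics
import Mathlib.RingTheory.MvPolynomial.WeightedHomogeneous
import HarnessLib

/-!
# Route `DepthWindow`, g8 — a generic `Σ Π` layer builder (gate level)

Gate-level piece (iii) of the `(2,3)` SLIVER LEMMA programme (lens-4 NODE-v8 §8–§10): appending to
a gate list `Ψ` one **product layer** (`prodLayer ops`: a product gate `∏_{u<f} ops j u` per index
`j < nJ`, fan-in exactly `f`) and one **collecting sum gate** (`sumGate c |Ψ|`: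
`Σ_j c_j · gate(|Ψ| + j)`), with the full bookkeeping a depth-window argument needs
(`sumProd_step`):

* values: the new sum gate holds `Σ_j C c_j · ∏_u (ops j u).eval (gateValues Ψ)`;
* depths: every new `prodWeight`-depth entry is `≤ D₀ + 1` when the operands have depth `≤ D₀`
  (one product level on top of the operands), old entries unchanged;
* homogeneity: if the values of `Ψ` are weighted homogeneous and every product `∏_u ops j u` is
  weighted homogeneous of the SAME weight `W`, all values of the extended list are weighted
  homogeneous.

Iterating the step gives `Σ Π Σ Π` realisations (the two-level jump formula
`weightedHomogeneousComponent_prod_eq_twoLevel_fix`, inner products fused with the product layer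
below, NODE-v7 §6 (4)); that iteration is the next file.  Generic circuit bookkeeping over a
commutative semiring; nothing here bears on `VP ≠ VNP`.

[cite: Burgisser2000, Def. 2.1] [cite: LimayeSrinivasanTavenas2025, Lemma 11]
-/

set_option linter.dupNamespace false

namespace Summit.ValiantsHypothesis.ValiantsHypothesis.Theorems.DepthWindow

open MvPolynomial Literature.Computability.AlgebraicComplexity ArithCircuit Finset
open Literature.Computability.AlgebraicComplexity.DepthReduction

variable {k : Type*} [CommSemiring k] {τ : Type*}

/-- The product layer: one product gate `∏_{u<f} ops j u` per index `j < nJ`. -/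
def prodLayer {nJ f : ℕ} (ops : Fin nJ → Fin f → Operand k τ) : List (Gate k τ) :=
  List.ofFn fun j : Fin nJ => Gate.prod (List.ofFn (ops j))

/-- The collecting sum gate `Σ_j c_j · gate(base + j)` over the product layer placed at `base`. -/
def sumGate {nJ : ℕ} (c : Fin nJ → k) (base : ℕ) : Gate k τ :=
  Gate.sum (List.ofFn fun j : Fin nJ => (c j, Operand.gate (base + j)))

section Layer

variable {nJ f : ℕ} (ops : Fin nJ → Fin f → Operand k τ)

omit [CommSemiring k] in
/-- The product layer has `nJ` gates. -/
@[simp] theorem length_prodLayer : (prodLayer ops).length = nJ := by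
  simp [prodLayer]

omit [CommSemiring k] in
/-- Every gate of the product layer is a product gate of fan-in exactly `f`. -/
theorem mem_prodLayer {g : Gate k τ} (hg : g ∈ prodLayer ops) :
    ∃ j : Fin nJ, g = Gate.prod (List.ofFn (ops j)) := by
  simp only [prodLayer, List.mem_ofFn] at hg
  obtain ⟨j, rfl⟩ := hg
  exact ⟨j, rfl⟩

omit [CommSemiring k] in
/-- Fan-in of the product layer. -/
theorem fanIn_prodLayer (vs : List (Operand k τ)) (h : Gate.prod vs ∈ prodLayer ops) :
    vs.length = f := by
  obtain ⟨j, hj⟩ := mem_prodLayer ops h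
  cases hj
  simp

omit [CommSemiring k] in
/-- The product layer has no sum gates. -/
theorem sum_not_mem_prodLayer (args : List (k × Operand k τ)) : Gate.sum args ∉ prodLayer ops := by
  intro h
  obtain ⟨j, hj⟩ := mem_prodLayer ops h
  cases hj

omit [CommSemiring k] in
/-- The operands of the product layer reference below `n` when the `ops` do. -/
theorem prodLayer_argsBelow (n : ℕ) (hrefs : ∀ j u, (ops j u).RefsBelow n) :
    ∀ g ∈ prodLayer ops, ∀ u ∈ g.args, u.RefsBelow n := by
  intro g hg u hu
  obtain ⟨j, rfl⟩ := mem_prodLayer ops hg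
  simp only [Gate.args, List.mem_ofFn] at hu
  obtain ⟨u', rfl⟩ := hu
  exact hrefs j u'

/-- **Values of the product layer.** -/
theorem gateValues_prodLayer (Ψ : List (Gate k τ)) (hrefs : ∀ j u, (ops j u).RefsBelow Ψ.length) :
    gateValues (Ψ ++ prodLayer ops) =
      gateValues Ψ ++ List.ofFn fun j : Fin nJ => ∏ u : Fin f, (ops j u).eval (gateValues Ψ) := by
  rw [gateValues_layer Ψ (prodLayer ops) (prodLayer_argsBelow ops Ψ.length hrefs)]
  congr 1
  simp only [prodLayer, List.map_ofFn]
  refine List.ofFn_inj.mpr (funext fun j => ?_)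
  simp only [Function.comp_apply, Gate.eval, List.map_ofFn, List.prod_ofFn]

omit [CommSemiring k] in
/-- **Depths of the product layer**: each new entry is one product level above its operands. -/
theorem gateWDepths_prodLayer (Ψ : List (Gate k τ)) (hrefs : ∀ j u, (ops j u).RefsBelow Ψ.length)
    (D₀ : ℕ) (hdp : ∀ j u, (ops j u).depthIn (gateWDepths prodWeight Ψ) ≤ D₀) :
    ∃ X : List ℕ, gateWDepths prodWeight (Ψ ++ prodLayer ops) = gateWDepths prodWeight Ψ ++ X ∧
      X.length = nJ ∧ ∀ x ∈ X, x ≤ D₀ + 1 := by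
  refine ⟨(prodLayer ops).map (Gate.depthAgainst prodWeight (gateWDepths prodWeight Ψ)),
    gateWDepths_append_block prodWeight Ψ _ (prodLayer_argsBelow ops Ψ.length hrefs), by simp, ?_⟩
  intro x hx
  simp only [List.mem_map] at hx
  obtain ⟨g, hg, rfl⟩ := hx
  obtain ⟨j, rfl⟩ := mem_prodLayer ops hg
  unfold Gate.depthAgainst
  have h1 : prodWeight (Gate.prod (List.ofFn (ops j)) : Gate k τ) = 1 := rfl
  rw [h1, Nat.add_comm]
  refine Nat.add_le_add_right (foldr_max_le fun x hx => ?_) 1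
  simp only [Gate.args, List.map_ofFn, List.mem_ofFn] at hx
  obtain ⟨u, rfl⟩ := hx
  exact hdp j u

end Layer

section Step

variable (w : τ → ℕ) {nJ f : ℕ} (c : Fin nJ → k) (ops : Fin nJ → Fin f → Operand k τ)

/-- The value of the collecting sum gate against the extended value list. -/
theorem eval_sumGate (Ψ : List (Gate k τ)) (hrefs : ∀ j u, (ops j u).RefsBelow Ψ.length) :
    (sumGate c Ψ.length : Gate k τ).eval (gateValues (Ψ ++ prodLayer ops)) =
      ∑ j : Fin nJ, C (c j) * ∏ u : Fin f, (ops j u).eval (gateValues Ψ) := by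
  rw [gateValues_prodLayer ops Ψ hrefs]
  simp only [sumGate, Gate.eval, List.map_ofFn, List.sum_ofFn]
  refine Finset.sum_congr rfl fun j _ => ?_
  simp only [Function.comp_apply, Operand.eval, smul_eq_C_mul]
  congr 1
  rw [← gateValues_length Ψ, getD_append_length_add,
    List.getD_eq_getElem _ _ (by simp), List.getElem_ofFn]

/-- **The `Σ Π` step.**  Appending the product layer and its collecting sum gate to `Ψ`:
homogeneity of all values, the depth window, and the value / position / depth of the new sum gate.
[cite: Burgisser2000, Def. 2.1] -/
theorem sumProd_step (Ψ : List (Gate k τ)) (D₀ W : ℕ)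
    (hrefs : ∀ j u, (ops j u).RefsBelow Ψ.length)
    (hdp : ∀ j u, (ops j u).depthIn (gateWDepths prodWeight Ψ) ≤ D₀)
    (hhom : ∀ g ∈ gateValues Ψ, ∃ e : ℕ, IsWeightedHomogeneous w g e)
    (hW : ∀ j, IsWeightedHomogeneous w (∏ u : Fin f, (ops j u).eval (gateValues Ψ)) W) :
    (Ψ ++ prodLayer ops ++ [sumGate c Ψ.length]).length = Ψ.length + nJ + 1 ∧
    (∀ vs : List (Operand k τ), Gate.prod vs ∈ prodLayer ops ++ [sumGate c Ψ.length] →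
      vs.length = f) ∧
    (∀ g ∈ gateValues (Ψ ++ prodLayer ops ++ [sumGate c Ψ.length]),
      ∃ e : ℕ, IsWeightedHomogeneous w g e) ∧
    (∀ x ∈ gateWDepths prodWeight (Ψ ++ prodLayer ops ++ [sumGate c Ψ.length]),
      x ∈ gateWDepths prodWeight Ψ ∨ x ≤ D₀ + 1) ∧
    (gateValues (Ψ ++ prodLayer ops ++ [sumGate c Ψ.length])).getD (Ψ.length + nJ) 0 =
      ∑ j : Fin nJ, C (c j) * ∏ u : Fin f, (ops j u).eval (gateValues Ψ) ∧
    IsWeightedHomogeneous w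
      ((gateValues (Ψ ++ prodLayer ops ++ [sumGate c Ψ.length])).getD (Ψ.length + nJ) 0) W ∧
    (gateWDepths prodWeight (Ψ ++ prodLayer ops ++ [sumGate c Ψ.length])).getD (Ψ.length + nJ) 0
      ≤ D₀ + 1 := by
  have hval : (gateValues (Ψ ++ prodLayer ops ++ [sumGate c Ψ.length])).getD (Ψ.length + nJ) 0 =
      ∑ j : Fin nJ, C (c j) * ∏ u : Fin f, (ops j u).eval (gateValues Ψ) := by
    rw [gateValues_append_singleton, getD_append_at_length _ _ _ (by simp), eval_sumGate c ops Ψ hrefs]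
  have hsumhom : IsWeightedHomogeneous w
      (∑ j : Fin nJ, C (c j) * ∏ u : Fin f, (ops j u).eval (gateValues Ψ)) W := by
    refine IsWeightedHomogeneous.sum _ _ W fun j _ => ?_
    simpa using (isWeightedHomogeneous_C w (c j)).mul (hW j)
  obtain ⟨X, hX, hXlen, hXle⟩ := gateWDepths_prodLayer ops Ψ hrefs D₀ hdp
  -- the depth entry of the sum gate
  have hSdepth : Gate.depthAgainst prodWeight (gateWDepths prodWeight (Ψ ++ prodLayer ops))
      (sumGate c Ψ.length : Gate k τ) ≤ D₀ + 1 := by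
    unfold Gate.depthAgainst
    have h0 : prodWeight (sumGate c Ψ.length : Gate k τ) = 0 := rfl
    rw [h0, Nat.zero_add]
    refine foldr_max_le fun x hx => ?_
    simp only [sumGate, Gate.args, List.map_ofFn, List.mem_ofFn] at hx
    obtain ⟨j, rfl⟩ := hx
    simp only [Function.comp_apply, Operand.depthIn]
    rw [hX, ← gateWDepths_length prodWeight Ψ, getD_append_length_add]
    exact getD_le_of_forall_le hXle _
  refine ⟨by simp [Nat.add_assoc], ?_, ?_, ?_, hval, hval ▸ hsumhom, ?_⟩
  · intro vs hvs
    rw [List.mem_append, List.mem_singleton] at hvs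
    rcases hvs with h | h
    · exact fanIn_prodLayer ops vs h
    · cases h
  · intro g hg
    rw [gateValues_append_singleton, List.mem_append, List.mem_singleton,
      gateValues_prodLayer ops Ψ hrefs, List.mem_append, List.mem_ofFn] at hg
    rcases hg with (hg | ⟨j, rfl⟩) | rfl
    · exact hhom g hg
    · exact ⟨W, hW j⟩
    · rw [← gateValues_prodLayer ops Ψ hrefs, eval_sumGate c ops Ψ hrefs]
      exact ⟨W, hsumhom⟩
  · intro x hx
    rw [gateWDepths_append_singleton, List.mem_append, List.mem_singleton] at hx
    rcases hx with hx | rfl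
    · rw [hX, List.mem_append] at hx
      rcases hx with hx | hx
      · exact Or.inl hx
      · exact Or.inr (hXle x hx)
    · exact Or.inr hSdepth
  · rw [gateWDepths_append_singleton, getD_append_at_length _ _ _
      (by rw [gateWDepths_length, List.length_append, length_prodLayer])]
    exact hSdepth

end Step

end Summit.ValiantsHypothesis.ValiantsHypothesis.Theorems.DepthWindow
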